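import Literature.Analysis.FluidPDE.PassiveScalarProofs
import Summits.FinalStateConjecture.FinalStateConjecture.Theorems.ClusterCompletenessAdiabaticMultiKerrILEDPhotonSphereAngularAux

/-!
# Route ClusterCompleteness — crux `AdiabaticMultiKerrILED`, line `Sketch`:
# photon-sphere angular control of the rest-frame tails-cut Schwarzschild zone

Helper file for the crux `stmt-FinalStateConjecture-14310`
(`Summit.FinalStateConjecture.FinalStateConjecture.Theses.ClusterCompleteness.AdiabaticMultiKerrILED`),
line `Sketch`, stub `restFrame_photonSphere_angular_le` (lead c7, wave 8: step (iii) of the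
non-degenerate integrated local energy decay — the angular derivatives near the photon sphere).

Setting (one zone, zero spin, rest frame): `G₀ = KerrSchild.inverseMetric (χ(2 − r/8M) · 2H) ℓ♯`
(`χ = Real.smoothTransition`, `r = Kerr.radius 0`, `H = M/r`), leaves `y ↦ (u + F(y), y)` of a `C²`
height `F` of slope `≤ ½`, static weight `Wt = χ(u₂/ε − 1) χ(2 − ‖x⃗‖²/R²)` (`R = 4M`).
Proof: with the Lagrangian current `L = KerrSchild.lagrangianCurrent G₀ (θ ∘ r) Φ` of the smooth
photon-sphere bump `θ` (`= 1` on `[5M/2, 7M/2]`, supported in `[9M/4, 15M/4]`), the pointwise bound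
`θ |∇̸Φ|² − 9 θ (∂₀Φ)² − ½ |□θ| Φ² ≤ ∑ ∂_μ L^μ` (`psAng_bulk_le_sum_fderiv`, using the equation)
holds at the slab points of the shell, where `Wt ≡ 1` nearby, while `L ≡ 0` near the other slab
points; `tailsCut_weighted_graph_le` integrates `Wt θ|∇̸Φ|² − Wt(9θ(∂₀Φ)² + ½|□θ|Φ²) ≤ ∑∂(Wt L)`
between the leaves, the leaf fluxes are at most `K₁ ∫_{shell} (M ∑(∂Φ)² + Φ²/M)`
(`lagrangianCurrent_leafFlux_abs_le`, `|□θ|, |θ′|` bounded on the shell by compactness), the bad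
bulk at most `K₂ ∫∫_{shell} ((∂₀Φ)² + Φ²/M²)`; all bounds are moved to `[0, ∞]`
(`ofReal_integral_le_lintegral_ofReal`, imported from the fluid-PDE literature where it landed),
`slab_lintegral_le_of_weighted_le` removes the weight, and `θ = 1` on the inner shell.
Dafermos–Rodnianski arXiv:0811.0354, §4.1.2 (the photon-sphere Lagrangian correction);
Dafermos–Rodnianski–Shlapentokh-Rothman arXiv:1402.7034, §2.3. [folklore]
-/

noncomputable section

-- the doubled `FinalStateConjecture.FinalStateConjecture` path component trips dupNamespace
set_option linter.dupNamespace false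

open Set Filter MeasureTheory
open scoped BigOperators Topology ENNReal ContDiff
open Literature.Geometry.Lorentzian
open Literature.Analysis.FluidPDE (ofReal_integral_le_lintegral_ofReal)

namespace Summit.FinalStateConjecture.FinalStateConjecture.Theorems

/-! ### The registered stub -/

/-- **Photon-sphere angular control** (crux `stmt-FinalStateConjecture-14310`, line `Sketch`, stub
`restFrame_photonSphere_angular_le`): for `M > 0` there is `K` such that for every `C²` height `F`
of slope `≤ ½`, every `Φ ∈ C²(ℝ⁴)` solving `□_{G₀} Φ = 0` on `{x⁰ ≥ F(x⃗), r > 2M}` and every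
`s ≥ 0`, the slab integral of the angular gradient `|∇̸Φ|² = ∑ᵢ(∂ᵢΦ)² − (x⃗·∇Φ/r)²` over the
leaves `u ∈ (0, s]` and the shell `5M/2 ≤ ‖y‖ ≤ 7M/2` is at most `K` times the energy-type fluxes
`∫ (M ∑(∂Φ)² + Φ²/M)` through the two boundary leaves over `9M/4 ≤ ‖y‖ ≤ 15M/4` plus the slab
integral of `(∂₀Φ)² + Φ²/M²` over that shell. Proof: the weighted Lagrangian current of the
photon-sphere bump (module docstring). Dafermos–Rodnianski arXiv:0811.0354, §4.1.2;
Dafermos–Rodnianski–Shlapentokh-Rothman arXiv:1402.7034, §2.3. [folklore] -/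
theorem restFrame_photonSphere_angular_le : ∀ (M : ℝ), 0 < M → ∃ K : NNReal, ∀ (F : E3 → ℝ) (Φ : E4 → ℝ) (s : ℝ),
    ContDiff ℝ 2 F → (∀ y, ‖fderiv ℝ F y‖ ≤ 2⁻¹) → ContDiff ℝ 2 Φ →
    (∀ x : E4, F (E4.spatial x) ≤ x 0 → 2 * M < Kerr.radius 0 x → KerrSchild.waveOperator (KerrSchild.inverseMetric (fun y ↦ Real.smoothTransition (2 - Kerr.radius 0 y / (8 * M)) * (2 * Kerr.scalarH M 0 y)) (Kerr.nullVector 0)) Φ x = 0) → 0 ≤ s →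
    ∫⁻ u in Set.Ioc 0 s, ∫⁻ y in {y : E3 | 5 * M / 2 ≤ ‖y‖ ∧ ‖y‖ ≤ 7 * M / 2}, ENNReal.ofReal ((∑ i : Fin 3, fderiv ℝ Φ (E4.ofTimeSpace (u + F y) y) (E4.basisVector i.succ) ^ 2) - ((∑ i : Fin 3, (E4.ofTimeSpace (u + F y) y) i.succ * fderiv ℝ Φ (E4.ofTimeSpace (u + F y) y) (E4.basisVector i.succ)) / Kerr.radius 0 (E4.ofTimeSpace (u + F y) y)) ^ 2) ≤
      (K : ENNReal) * ((∫⁻ y in {y : E3 | 9 * M / 4 ≤ ‖y‖ ∧ ‖y‖ ≤ 15 * M / 4}, ENNReal.ofReal (M * (∑ μ : Fin 4, fderiv ℝ Φ (E4.ofTimeSpace (0 + F y) y) (E4.basisVector μ) ^ 2) + Φ (E4.ofTimeSpace (0 + F y) y) ^ 2 / M)) +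
        (∫⁻ y in {y : E3 | 9 * M / 4 ≤ ‖y‖ ∧ ‖y‖ ≤ 15 * M / 4}, ENNReal.ofReal (M * (∑ μ : Fin 4, fderiv ℝ Φ (E4.ofTimeSpace (s + F y) y) (E4.basisVector μ) ^ 2) + Φ (E4.ofTimeSpace (s + F y) y) ^ 2 / M)) +
        (∫⁻ u in Set.Ioc 0 s, ∫⁻ y in {y : E3 | 9 * M / 4 ≤ ‖y‖ ∧ ‖y‖ ≤ 15 * M / 4},
          ENNReal.ofReal (fderiv ℝ Φ (E4.ofTimeSpace (u + F y) y) (E4.basisVector 0) ^ 2 + Φ (E4.ofTimeSpace (u + F y) y) ^ 2 / M ^ 2))) := by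
  intro M hM
  -- ### the bump `θ` and the radial expression `D` of `□ θ`
  obtain ⟨θ, hθs, hθ2, hθz, hθ1, hθ01⟩ : ∃ θ : ℝ → ℝ, ContDiff ℝ ∞ θ ∧ ContDiff ℝ 2 θ ∧
      (∀ t, t < 9 * M / 4 ∨ 15 * M / 4 < t → θ t = 0) ∧
      (∀ t, 5 * M / 2 ≤ t → t ≤ 7 * M / 2 → θ t = 1) ∧ (∀ t, 0 ≤ θ t ∧ θ t ≤ 1) :=
    ⟨_, psAng_bump_contDiff M, psAng_bump_contDiff M, fun t ht ↦ psAng_bump_eq_zero hM ht,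
      fun t ht1 ht2 ↦ psAng_bump_eq_one hM ht1 ht2, psAng_bump_mem M⟩
  have hVo : IsOpen (Iio (9 * M / 4) ∪ Ioi (15 * M / 4)) := isOpen_Iio.union isOpen_Ioi
  have hθV : ∀ t ∈ Iio (9 * M / 4) ∪ Ioi (15 * M / 4), θ t = 0 := fun t ht ↦ hθz t ht
  set D : ℝ → ℝ := fun r ↦ r⁻¹ ^ 2 * deriv (fun s ↦ s ^ 2 *
    (fun s : ℝ ↦ 1 - Real.smoothTransition (2 - s / (8 * M)) * (2 * M / s)) s * deriv θ s) r
    with hD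
  have hDc : ∀ r, 0 < r → ContinuousAt D r := fun r hr ↦ psAng_continuousAt_radialBox hθs M hr.ne'
  have hDV : ∀ r ∈ Iio (9 * M / 4) ∪ Ioi (15 * M / 4), D r = 0 := fun r hr ↦
    psAng_radialBox_eq_zero hVo hθV M hr
  -- ### the constants (compactness on the shell of radii)
  obtain ⟨K₀, hK₀⟩ := (isCompact_Icc (a := 9 * M / 4) (b := 15 * M / 4)).exists_bound_of_continuousOn
    (f := D) fun r hr ↦ (hDc r (lt_of_lt_of_le (by positivity) hr.1)).continuousWithinAt
  obtain ⟨cd, hcd⟩ := (isCompact_Icc (a := 9 * M / 4) (b := 15 * M / 4)).exists_bound_of_continuousOn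
    (f := deriv θ) (hθ2.continuous_deriv (by norm_num)).continuousOn
  set K₁ : ℝ := 16 + 16 * max cd 0 * M with hK₁
  set K₂ : ℝ := max 9 (max K₀ 0 * M ^ 2 / 2) with hK₂
  have hK₁0 : 0 ≤ K₁ := by positivity
  have hK₂9 : 9 ≤ K₂ := le_max_left _ _
  have hKpos : 0 < max K₁ K₂ := lt_of_lt_of_le (by linarith) (le_max_right _ _)
  refine ⟨(max K₁ K₂).toNNReal, ?_⟩
  intro F Φ s hF hdF hΦ hwave hs
  rw [ENNReal.ofNNReal_toNNReal]
  -- ### notation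
  set G : E4 → Fin 4 → Fin 4 → ℝ := KerrSchild.inverseMetric
    (fun y ↦ Real.smoothTransition (2 - Kerr.radius 0 y / (8 * M)) * (2 * Kerr.scalarH M 0 y))
    (Kerr.nullVector 0) with hG
  set ang : E4 → ℝ := fun x ↦ (∑ i : Fin 3, fderiv ℝ Φ x (E4.basisVector i.succ) ^ 2) -
    ((∑ i : Fin 3, x i.succ * fderiv ℝ Φ x (E4.basisVector i.succ)) / Kerr.radius 0 x) ^ 2
    with hang
  set b : E4 → ℝ := fun x ↦ θ (Kerr.radius 0 x) * ang x with hb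
  set bad : E4 → ℝ := fun x ↦ 9 * θ (Kerr.radius 0 x) * fderiv ℝ Φ x (E4.basisVector 0) ^ 2 +
    2⁻¹ * |D (Kerr.radius 0 x)| * Φ x ^ 2 with hbad
  set Ssh : Set E3 := {y : E3 | 9 * M / 4 ≤ ‖y‖ ∧ ‖y‖ ≤ 15 * M / 4} with hSsh
  set ed : ℝ → E3 → ℝ≥0∞ := fun t y ↦ ENNReal.ofReal (M * (∑ μ : Fin 4,
    fderiv ℝ Φ (E4.ofTimeSpace (t + F y) y) (E4.basisVector μ) ^ 2) +
      Φ (E4.ofTimeSpace (t + F y) y) ^ 2 / M) with hed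
  set bd : ℝ → E3 → ℝ≥0∞ := fun u y ↦ ENNReal.ofReal
    (fderiv ℝ Φ (E4.ofTimeSpace (u + F y) y) (E4.basisVector 0) ^ 2 +
      Φ (E4.ofTimeSpace (u + F y) y) ^ 2 / M ^ 2) with hbd
  set I0 : ℝ≥0∞ := ∫⁻ y in Ssh, ed 0 y with hI0
  set Is : ℝ≥0∞ := ∫⁻ y in Ssh, ed s y with hIs
  set Ib : ℝ≥0∞ := ∫⁻ u in Ioc 0 s, ∫⁻ y in Ssh, bd u y with hIb
  show ∫⁻ u in Ioc 0 s, ∫⁻ y in {y : E3 | 5 * M / 2 ≤ ‖y‖ ∧ ‖y‖ ≤ 7 * M / 2},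
      ENNReal.ofReal (ang (E4.ofTimeSpace (u + F y) y)) ≤
    ENNReal.ofReal (max K₁ K₂) * (I0 + Is + Ib)
  -- ### the trivial case of an infinite right-hand side
  rcases eq_or_ne (I0 + Is + Ib) ⊤ with htop | htop
  · rw [htop, ENNReal.mul_top (ENNReal.ofReal_pos.mpr hKpos).ne']
    exact le_top
  obtain ⟨h0s, hIbf⟩ := ENNReal.add_ne_top.mp htop
  obtain ⟨hI0f, hIsf⟩ := ENNReal.add_ne_top.mp h0s
  -- ### general facts
  set R : ℝ := 4 * M with hR
  have hR0 : 0 < R := by positivity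
  have hR4 : 4 * M ≤ R := le_rfl
  have hlip : ∀ y : E3, |F y - F 0| ≤ 2⁻¹ * ‖y - 0‖ := fun y ↦ by
    rw [← Real.norm_eq_abs]
    exact convex_univ.norm_image_sub_le_of_norm_fderiv_le
      (fun z _ ↦ hF.differentiable (by simp) z) (fun z _ ↦ hdF z) (mem_univ 0) (mem_univ y)
  have hFub : ∀ y : E3, F y ≤ |F 0| + 2⁻¹ * ‖y‖ := fun y ↦ by
    have h := (abs_le.mp (hlip y)).2
    rw [sub_zero] at h
    linarith [le_abs_self (F 0)]
  have hrad : ∀ (t : ℝ) (y : E3), Kerr.radius 0 (E4.ofTimeSpace (t + F y) y) = ‖y‖ := fun t y ↦ by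
    rw [Kerr.radius_zero_left, E4.spatialNorm_ofTimeSpace]
  have hSm : MeasurableSet Ssh :=
    (isClosed_le continuous_const continuous_norm).measurableSet.inter
      (isClosed_le continuous_norm continuous_const).measurableSet
  have hnotS : ∀ y : E3, y ∉ Ssh → ‖y‖ ∈ Iio (9 * M / 4) ∪ Ioi (15 * M / 4) := fun y hy ↦ by
    simp only [hSsh, mem_setOf_eq, not_and_or, not_le] at hy
    simpa only [mem_union, mem_Iio, mem_Ioi] using hy
  have hG2 : ∀ x : E4, 2 * M < Kerr.radius 0 x → ∀ α β, |G x α β| ≤ 2 := fun x hx ↦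
    morawetzLeaf_abs_inverseMetric_le hM hx
  have hdc : ∀ μ, Continuous fun y ↦ fderiv ℝ Φ y (E4.basisVector μ) := fun μ ↦
    (hΦ.continuous_fderiv two_ne_zero).clm_apply continuous_const
  have hθc : Continuous fun x : E4 ↦ θ (Kerr.radius 0 x) :=
    hθs.continuous.comp (Kerr.continuous_radius 0)
  have hangc : ∀ x : E4, 0 < Kerr.radius 0 x → ContinuousAt ang x := fun x hx ↦ by
    have hr : ContinuousAt (Kerr.radius 0) x := (Kerr.continuous_radius 0).continuousAt
    have hS : ContinuousAt
        (fun y : E4 ↦ ∑ i : Fin 3, y i.succ * fderiv ℝ Φ y (E4.basisVector i.succ)) x :=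
      (continuous_finsetSum _ fun i _ ↦
        ((Kerr.contDiff_coord i.succ (n := 0)).continuous).mul (hdc i.succ)).continuousAt
    have hS2 : ContinuousAt
        (fun y : E4 ↦ ∑ i : Fin 3, fderiv ℝ Φ y (E4.basisVector i.succ) ^ 2) x :=
      (continuous_finsetSum _ fun i _ ↦ (hdc i.succ).pow 2).continuousAt
    exact hS2.sub ((hS.div hr hx.ne').pow 2)
  have hbc : ∀ x : E4, 2 * M < Kerr.radius 0 x → ContinuousAt b x ∧ 0 ≤ b x := fun x hx ↦ by
    have hxpos : 0 < Kerr.radius 0 x := lt_trans (by positivity) hx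
    exact ⟨hθc.continuousAt.mul (hangc x hxpos),
      mul_nonneg (hθ01 _).1 (psAng_angular_nonneg Φ hxpos)⟩
  have hbadc : ∀ x : E4, 2 * M < Kerr.radius 0 x → ContinuousAt bad x ∧ 0 ≤ bad x := fun x hx ↦ by
    have hxpos : 0 < Kerr.radius 0 x := lt_trans (by positivity) hx
    have hDr : ContinuousAt (fun y : E4 ↦ D (Kerr.radius 0 y)) x :=
      (hDc _ hxpos).comp (Kerr.continuous_radius 0).continuousAt
    exact ⟨((continuousAt_const.mul hθc.continuousAt).mul ((hdc 0).continuousAt.pow 2)).add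
      ((continuousAt_const.mul hDr.abs).mul (hΦ.continuous.continuousAt.pow 2)),
      add_nonneg (mul_nonneg (mul_nonneg (by norm_num) (hθ01 _).1) (sq_nonneg _))
        (mul_nonneg (mul_nonneg (by norm_num) (abs_nonneg _)) (sq_nonneg _))⟩
  -- ### pointwise bounds on the shell: the leaf flux and the bad bulk
  have hleaf : ∀ y ∈ Ssh, ∀ t : ℝ,
      |∑ μ, KerrSchild.lagrangianCurrent G (fun z ↦ θ (Kerr.radius 0 z)) Φ
        (E4.ofTimeSpace (t + F y) y) μ * Kerr.graphConormal F y μ| ≤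
      K₁ * (M * (∑ μ : Fin 4, fderiv ℝ Φ (E4.ofTimeSpace (t + F y) y) (E4.basisVector μ) ^ 2) +
        Φ (E4.ofTimeSpace (t + F y) y) ^ 2 / M) := by
    intro y hy t
    have hx : 2 * M < Kerr.radius 0 (E4.ofTimeSpace (t + F y) y) := by rw [hrad]; linarith [hy.1]
    have hxpos : 0 < Kerr.radius 0 (E4.ofTimeSpace (t + F y) y) := lt_trans (by positivity) hx
    refine lagrangianCurrent_leafFlux_abs_le G _ Φ _ _ M _ hM (le_max_right _ _) (hG2 _ hx)
      (morawetzLeaf_abs_conormal_le (Kerr.graphConormal_zero F y) (restFrame_graphConormal_sq_le hdF y))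
      ?_ (fun ν ↦ ?_)
    · rw [abs_of_nonneg (hθ01 _).1]
      exact (hθ01 _).2
    · refine (psAng_abs_fderiv_comp_radius_le hxpos (hθ2.differentiable two_ne_zero _) ν).trans ?_
      have h := hcd ‖y‖ ⟨hy.1, hy.2⟩
      rw [Real.norm_eq_abs] at h
      rw [hrad]
      exact h.trans (le_max_left _ _)
  have hbadle : ∀ y ∈ Ssh, ∀ u : ℝ, bad (E4.ofTimeSpace (u + F y) y) ≤
      K₂ * (fderiv ℝ Φ (E4.ofTimeSpace (u + F y) y) (E4.basisVector 0) ^ 2 +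
        Φ (E4.ofTimeSpace (u + F y) y) ^ 2 / M ^ 2) := by
    intro y hy u
    have hDy : |D ‖y‖| ≤ max K₀ 0 := by
      have h := hK₀ ‖y‖ ⟨hy.1, hy.2⟩
      rw [Real.norm_eq_abs] at h
      exact h.trans (le_max_left _ _)
    have hθy := (hθ01 ‖y‖).2
    have h9 : (9 : ℝ) ≤ K₂ := hK₂9
    have hKK : max K₀ 0 * M ^ 2 / 2 ≤ K₂ := le_max_right _ _
    show 9 * θ (Kerr.radius 0 _) * _ + 2⁻¹ * |D (Kerr.radius 0 _)| * _ ≤ _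
    rw [hrad]
    set p : ℝ := fderiv ℝ Φ (E4.ofTimeSpace (u + F y) y) (E4.basisVector 0) ^ 2
    set q : ℝ := Φ (E4.ofTimeSpace (u + F y) y) ^ 2
    have hp : 0 ≤ p := sq_nonneg _
    have hq : 0 ≤ q := sq_nonneg _
    have h1 : 9 * θ ‖y‖ * p ≤ K₂ * p := by nlinarith [(hθ01 ‖y‖).1]
    have h2 : 2⁻¹ * |D ‖y‖| * q ≤ K₂ * (q / M ^ 2) := by
      have hM2 : 0 < M ^ 2 := by positivity
      rw [mul_div_assoc', le_div_iff₀ hM2]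
      nlinarith [abs_nonneg (D ‖y‖), mul_le_mul_of_nonneg_right hDy hq]
    nlinarith [h1, h2]
  -- ### Step 1: the weighted real inequality for every admissible `ε`
  set A : ℝ := (ENNReal.ofReal K₁ * I0).toReal + (ENNReal.ofReal K₁ * Is).toReal +
    (ENNReal.ofReal K₂ * Ib).toReal with hA
  have hstep : ∀ ε : ℝ, 0 < ε → 16 * ε * Real.exp ((s + |F 0| + 2 * R) / (2 * M)) ≤ M →
      ∫ u in Ioc 0 s, ∫ y : E3, (Real.smoothTransition (Kerr.horizonFn M 0
        (E4.ofTimeSpace (u + F y) y) / ε - 1) * Real.smoothTransition (2 - E4.spatialNorm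
          (E4.ofTimeSpace (u + F y) y) ^ 2 / R ^ 2)) * b (E4.ofTimeSpace (u + F y) y) ≤ A := by
    intro ε hε hεM
    set Wt : E4 → ℝ := fun y ↦ Real.smoothTransition (Kerr.horizonFn M 0 y / ε - 1) *
      Real.smoothTransition (2 - E4.spatialNorm y ^ 2 / R ^ 2) with hWt
    set e : E4 → ℝ := fun x ↦ Wt x * bad x with he
    have hW01 : ∀ x, 0 ≤ Wt x ∧ Wt x ≤ 1 := fun x ↦
      ⟨mul_nonneg (Real.smoothTransition.nonneg _) (Real.smoothTransition.nonneg _),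
        mul_le_one₀ (Real.smoothTransition.le_one _) (Real.smoothTransition.nonneg _)
          (Real.smoothTransition.le_one _)⟩
    have hWL : ∀ μ : Fin 4, ContDiff ℝ 1 fun y ↦ Wt y *
        KerrSchild.lagrangianCurrent G (fun z ↦ θ (Kerr.radius 0 z)) Φ y μ := fun μ ↦
      psAng_contDiff_weighted_lagrangian R hM hε
        (fun x hx μ ν ↦ contDiffAt_tailsCut_inverseMetric M 0 hx μ ν) hθ2 hΦ μ
    have hec : Continuous e := continuous_tailsCutWeight_mul R hM hε fun x hx ↦ (hbadc x hx).1
    have he0 : ∀ x, 0 ≤ e x := fun x ↦ by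
      by_cases hx : 2 * M < Kerr.radius 0 x
      · exact mul_nonneg (hW01 x).1 (hbadc x hx).2
      · have h1 : Kerr.horizonFn M 0 x < ε := by
          refine lt_of_le_of_lt ?_ hε
          unfold Kerr.horizonFn
          rw [Kerr.rPlus_zero_right hM.le]
          exact mul_nonpos_iff.mpr (Or.inr ⟨by linarith, (Real.exp_pos _).le⟩)
        show 0 ≤ Real.smoothTransition (Kerr.horizonFn M 0 x / ε - 1) *
          Real.smoothTransition (2 - E4.spatialNorm x ^ 2 / R ^ 2) * bad x
        rw [tailsCutWeight_eq_zero_of_horizonFn_lt hε h1, zero_mul]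
    have heK : ∀ x : E4, (Kerr.horizonFn M 0 x < ε ∨ 2 * R ^ 2 < E4.spatialNorm x ^ 2) →
        e x = 0 := by
      rintro x (hx | hx) <;>
        show Real.smoothTransition (Kerr.horizonFn M 0 x / ε - 1) *
          Real.smoothTransition (2 - E4.spatialNorm x ^ 2 / R ^ 2) * bad x = 0
      · rw [tailsCutWeight_eq_zero_of_horizonFn_lt hε hx, zero_mul]
      · rw [tailsCutWeight_eq_zero_of_lt_spatialNorm_sq hR0 hx, zero_mul]
    -- the pointwise inequality on the slab
    have hdiv : ∀ x : E4, F (E4.spatial x) ≤ x 0 → x 0 ≤ s + F (E4.spatial x) →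
        2 * M < Kerr.radius 0 x → Wt x * b x - e x ≤ ∑ μ, fderiv ℝ (fun y ↦ Wt y *
          KerrSchild.lagrangianCurrent G (fun z ↦ θ (Kerr.radius 0 z)) Φ y μ) x
            (E4.basisVector μ) := by
      intro x hx1 hx2 hx3
      by_cases hxV : Kerr.radius 0 x ∈ Iio (9 * M / 4) ∪ Ioi (15 * M / 4)
      · rw [psAng_sum_fderiv_weighted_eq_zero G Φ Wt hVo hθV hxV]
        have hθ0 : θ (Kerr.radius 0 x) = 0 := hθV _ hxV
        have hD0 : D (Kerr.radius 0 x) = 0 := hDV _ hxV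
        show Wt x * (θ (Kerr.radius 0 x) * ang x) - Wt x * (9 * θ (Kerr.radius 0 x) *
          fderiv ℝ Φ x (E4.basisVector 0) ^ 2 + 2⁻¹ * |D (Kerr.radius 0 x)| * Φ x ^ 2) ≤ 0
        rw [hθ0, hD0, abs_zero]
        simp
      · have hsh : 9 * M / 4 ≤ Kerr.radius 0 x ∧ Kerr.radius 0 x ≤ 15 * M / 4 := by
          simpa only [mem_union, mem_Iio, mem_Ioi, not_or, not_lt] using hxV
        have hev := psAng_weight_eventuallyEq_one hM hε hR4 hεM hFub hx2 hsh.1 hsh.2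
        have hWt1 : Wt x = 1 := hev.eq_of_nhds
        have hsum : ∑ μ, fderiv ℝ (fun y ↦ Wt y *
            KerrSchild.lagrangianCurrent G (fun z ↦ θ (Kerr.radius 0 z)) Φ y μ) x
              (E4.basisVector μ) = ∑ μ, fderiv ℝ (fun y ↦
            KerrSchild.lagrangianCurrent G (fun z ↦ θ (Kerr.radius 0 z)) Φ y μ) x
              (E4.basisVector μ) := by
          refine Finset.sum_congr rfl fun μ _ ↦ ?_
          have hev' : (fun y ↦ Wt y *
              KerrSchild.lagrangianCurrent G (fun z ↦ θ (Kerr.radius 0 z)) Φ y μ) =ᶠ[𝓝 x]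
              fun y ↦ KerrSchild.lagrangianCurrent G (fun z ↦ θ (Kerr.radius 0 z)) Φ y μ := by
            filter_upwards [hev] with y hy
            have hy1 : Wt y = 1 := hy
            rw [hy1, one_mul]
          rw [hev'.fderiv_eq]
        have key : b x - bad x ≤ ∑ μ, fderiv ℝ (fun y ↦
            KerrSchild.lagrangianCurrent G (fun z ↦ θ (Kerr.radius 0 z)) Φ y μ) x
              (E4.basisVector μ) :=
          psAng_bulk_le_sum_fderiv hM hsh.1 (by linarith [hsh.2]) hθ2.contDiffAt (hθ01 _).1
            hΦ.contDiffAt (hwave x hx1 hx3)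
        show Wt x * b x - Wt x * bad x ≤ _
        rw [hsum, hWt1, one_mul, one_mul]
        exact key
    have hmain := tailsCut_weighted_graph_le M ε R F
      (KerrSchild.lagrangianCurrent G (fun z ↦ θ (Kerr.radius 0 z)) Φ) b e s hM hε hR0 hF hdF
      hs hWL (fun x hx ↦ (hbc x hx).1) hec he0 heK hdiv
    -- the leaf fluxes in `[0, ∞]`
    have hflux : ∀ (t σ' : ℝ), (σ' = 1 ∨ σ' = -1) →
        ENNReal.ofReal (σ' * ∫ y : E3, Wt (E4.ofTimeSpace (t + F y) y) *
          (-∑ μ, KerrSchild.lagrangianCurrent G (fun z ↦ θ (Kerr.radius 0 z)) Φ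
            (E4.ofTimeSpace (t + F y) y) μ * Kerr.graphConormal F y μ)) ≤
        ENNReal.ofReal K₁ * ∫⁻ y in Ssh, ed t y := by
      intro t σ' hσ
      have hσ1 : |σ'| = 1 := by rcases hσ with h | h <;> simp [h]
      rw [← integral_const_mul]
      refine (ofReal_integral_le_lintegral_ofReal _).trans ?_
      calc _ ≤ ∫⁻ y, Ssh.indicator (fun y ↦ ENNReal.ofReal K₁ * ed t y) y :=
            lintegral_mono fun y ↦ ?_
        _ = ENNReal.ofReal K₁ * ∫⁻ y in Ssh, ed t y := by
            rw [lintegral_indicator hSm, lintegral_const_mul' _ _ ENNReal.ofReal_ne_top]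
      by_cases hy : y ∈ Ssh
      · rw [indicator_of_mem hy, hed, ← ENNReal.ofReal_mul hK₁0]
        refine ENNReal.ofReal_le_ofReal ?_
        refine (le_abs_self _).trans ?_
        rw [abs_mul, hσ1, one_mul, abs_mul, abs_neg, abs_of_nonneg (hW01 _).1]
        exact (mul_le_mul_of_nonneg_right (hW01 _).2 (abs_nonneg _)).trans
          ((one_mul _).trans_le (hleaf y hy t))
      · rw [indicator_of_notMem hy]
        have hyV : Kerr.radius 0 (E4.ofTimeSpace (t + F y) y) ∈ Iio (9 * M / 4) ∪ Ioi (15 * M / 4) := by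
          rw [hrad]
          exact hnotS y hy
        have h0 : ∑ μ, KerrSchild.lagrangianCurrent G (fun z ↦ θ (Kerr.radius 0 z)) Φ
            (E4.ofTimeSpace (t + F y) y) μ * Kerr.graphConormal F y μ = 0 :=
          Finset.sum_eq_zero fun μ _ ↦ by
            rw [psAng_lagrangian_eq_zero G Φ hVo hθV hyV μ, zero_mul]
        rw [h0, neg_zero, mul_zero, mul_zero, ENNReal.ofReal_zero]
    -- the bad bulk in `[0, ∞]`
    have hbulk : ENNReal.ofReal (∫ u in Ioc 0 s, ∫ y : E3, e (E4.ofTimeSpace (u + F y) y)) ≤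
        ENNReal.ofReal K₂ * Ib := by
      refine (ofReal_integral_le_lintegral_ofReal _).trans ?_
      calc ∫⁻ u in Ioc 0 s, ENNReal.ofReal (∫ y : E3, e (E4.ofTimeSpace (u + F y) y))
          ≤ ∫⁻ u in Ioc 0 s, ∫⁻ y, Ssh.indicator (fun y ↦ ENNReal.ofReal K₂ * bd u y) y :=
            lintegral_mono fun u ↦ (ofReal_integral_le_lintegral_ofReal _).trans (lintegral_mono fun y ↦ ?_)
        _ = ENNReal.ofReal K₂ * Ib := by
            simp only [lintegral_indicator hSm]
            rw [hIb, ← lintegral_const_mul' _ _ ENNReal.ofReal_ne_top]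
            exact lintegral_congr fun u ↦ lintegral_const_mul' _ _ ENNReal.ofReal_ne_top
      by_cases hy : y ∈ Ssh
      · rw [indicator_of_mem hy, hbd, ← ENNReal.ofReal_mul (by linarith : (0 : ℝ) ≤ K₂)]
        refine ENNReal.ofReal_le_ofReal ?_
        have hx : 2 * M < Kerr.radius 0 (E4.ofTimeSpace (u + F y) y) := by
          rw [hrad]; linarith [hy.1]
        calc e (E4.ofTimeSpace (u + F y) y) ≤ 1 * bad (E4.ofTimeSpace (u + F y) y) :=
              mul_le_mul_of_nonneg_right (hW01 _).2 (hbadc _ hx).2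
          _ ≤ _ := by rw [one_mul]; exact hbadle y hy u
      · rw [indicator_of_notMem hy]
        have hyV : ‖y‖ ∈ Iio (9 * M / 4) ∪ Ioi (15 * M / 4) := hnotS y hy
        have h0 : bad (E4.ofTimeSpace (u + F y) y) = 0 := by
          show 9 * θ (Kerr.radius 0 _) * _ + 2⁻¹ * |D (Kerr.radius 0 _)| * _ = 0
          rw [hrad, hθV _ hyV, hDV _ hyV, abs_zero]
          simp
        show ENNReal.ofReal (Wt _ * bad _) ≤ 0
        rw [h0, mul_zero, ENNReal.ofReal_zero]
    -- assemble the real inequality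
    have hf0 := (ENNReal.ofReal_le_iff_le_toReal (ENNReal.mul_ne_top ENNReal.ofReal_ne_top hI0f)).mp
      (hflux 0 1 (Or.inl rfl))
    have hfs := (ENNReal.ofReal_le_iff_le_toReal (ENNReal.mul_ne_top ENNReal.ofReal_ne_top hIsf)).mp
      (hflux s (-1) (Or.inr rfl))
    have hbk := (ENNReal.ofReal_le_iff_le_toReal (ENNReal.mul_ne_top ENNReal.ofReal_ne_top hIbf)).mp
      hbulk
    rw [one_mul] at hf0
    rw [neg_one_mul] at hfs
    have hmain' : ∫ u in Ioc 0 s, ∫ y : E3, Wt (E4.ofTimeSpace (u + F y) y) *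
        b (E4.ofTimeSpace (u + F y) y) ≤ _ := hmain
    show ∫ u in Ioc 0 s, ∫ y : E3, Wt (E4.ofTimeSpace (u + F y) y) *
        b (E4.ofTimeSpace (u + F y) y) ≤ A
    linarith [hmain', hf0, hfs, hbk]
  -- ### Step 2: remove the weight and compare the regions
  have hslab := slab_lintegral_le_of_weighted_le M R F b s A hM hR0 hF.continuous hs hbc hstep
  have hTm : MeasurableSet {y : E3 | 5 * M / 2 ≤ ‖y‖ ∧ ‖y‖ ≤ 7 * M / 2} :=
    (isClosed_le continuous_const continuous_norm).measurableSet.inter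
      (isClosed_le continuous_norm continuous_const).measurableSet
  calc ∫⁻ u in Ioc 0 s, ∫⁻ y in {y : E3 | 5 * M / 2 ≤ ‖y‖ ∧ ‖y‖ ≤ 7 * M / 2},
        ENNReal.ofReal (ang (E4.ofTimeSpace (u + F y) y))
      ≤ ∫⁻ u in Ioc 0 s, ∫⁻ y in {y : E3 | 2 * M < ‖y‖ ∧ ‖y‖ ≤ R},
          ENNReal.ofReal (b (E4.ofTimeSpace (u + F y) y)) := by
        refine lintegral_mono fun u ↦ ?_
        calc ∫⁻ y in {y : E3 | 5 * M / 2 ≤ ‖y‖ ∧ ‖y‖ ≤ 7 * M / 2},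
              ENNReal.ofReal (ang (E4.ofTimeSpace (u + F y) y))
            = ∫⁻ y in {y : E3 | 5 * M / 2 ≤ ‖y‖ ∧ ‖y‖ ≤ 7 * M / 2},
              ENNReal.ofReal (b (E4.ofTimeSpace (u + F y) y)) :=
              setLIntegral_congr_fun hTm fun y hy ↦ by
                show ENNReal.ofReal _ = ENNReal.ofReal (θ (Kerr.radius 0 _) * ang _)
                rw [hrad, hθ1 _ hy.1 hy.2, one_mul]
          _ ≤ _ := lintegral_mono_set (show {y : E3 | 5 * M / 2 ≤ ‖y‖ ∧ ‖y‖ ≤ 7 * M / 2} ⊆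
              {y : E3 | 2 * M < ‖y‖ ∧ ‖y‖ ≤ R} from fun y hy ↦ by
                simp only [mem_setOf_eq] at hy ⊢
                constructor <;> linarith [hy.1, hy.2])
    _ ≤ ENNReal.ofReal A := hslab
    _ = ENNReal.ofReal K₁ * I0 + ENNReal.ofReal K₁ * Is + ENNReal.ofReal K₂ * Ib := by
        rw [hA, ENNReal.ofReal_add (by positivity) (by positivity),
          ENNReal.ofReal_add (by positivity) (by positivity),
          ENNReal.ofReal_toReal (ENNReal.mul_ne_top ENNReal.ofReal_ne_top hI0f),
          ENNReal.ofReal_toReal (ENNReal.mul_ne_top ENNReal.ofReal_ne_top hIsf),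
          ENNReal.ofReal_toReal (ENNReal.mul_ne_top ENNReal.ofReal_ne_top hIbf)]
    _ ≤ ENNReal.ofReal (max K₁ K₂) * (I0 + Is + Ib) := by
        rw [mul_add, mul_add]
        gcongr
        · exact le_max_left _ _
        · exact le_max_left _ _
        · exact le_max_right _ _

end Summit.FinalStateConjecture.FinalStateConjecture.Theorems
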